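import Mathlib.Analysis.Calculus.InverseFunctionTheorem.FDeriv
import Mathlib.Analysis.Calculus.FDeriv.Mul
import Mathlib.Analysis.Matrix.Normed
import Mathlib.Topology.UniformSpace.Matrix
import HarnessLib

/-!
# Square roots near `1`: `a ↦ a·a` is a local homeomorphism at `1` in a complete normed algebra (`2 ≠ 0`), in `M_n(K)`
# and in `M_n(∏_i K_i)` for complete nontrivially normed fields
(Dieudonné, *Foundations of Modern Analysis* (1960), (10.2.5) inverse function theorem; Mathlib
`HasStrictFDerivAt.toOpenPartialHomeomorph`)

Topic `Analysis/Calculus`; namespace `Literature.Analysis.Calculus`.  THEOREMS ONLY (no definition, no instance, no named fact, no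
`sorry`).  Written for the cell `pub/hodgecm-mathlib` (ENGINE T1): the analytic input of «regular semisimple conjugacy classes of
the local unitary groups `U(H)(L⁺_v) ⊂ GL_N(∏_{w∣v} L_w)` are closed» (`NumberTheory/Automorphic/UnitaryConjClassClosed`,
`…/LocalRegularOrbitClosed`), where the cocycle `h ↦ σ(h)ᵀ J h` separating the `U(H)`-classes inside a stable class is shown
to be locally constant by extracting square roots near `1`.

* `exists_isOpen_injOn_mul_self` — `𝕜` nontrivially normed with `(2 : 𝕜) ≠ 0`, `B` a complete normed `𝕜`-algebra: there is
  an open `U ∋ 1` on which `a ↦ a·a` is injective, and `map (a ↦ a·a) (𝓝 1) = 𝓝 1` (the strict derivative at `1` is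
  `2·id`, a linear homeomorphism; inverse function theorem);
* `exists_isOpen_injOn_mul_self_matrix` — the same in `M_n(K)` with its product topology (`K` complete; Mathlib's
  `L^∞`-operator norm `Matrix.linftyOpNormedAlgebra` induces the product uniformity);
* `exists_isOpen_injOn_mul_self_matrix_pi` — the same in `M_n(∏_i K_i)` for finitely many complete fields `K_i`
  (componentwise), in the form «`∃ U` open `∋ 1`, squaring injective on `U`, and `(a ↦ a·a) '' V ∈ 𝓝 1` for every
  `V ∈ 𝓝 1`».

## References
* J. Dieudonné, *Foundations of Modern Analysis* (1960), (10.2.5) [Dieudonne1960].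
-/

noncomputable section

open Filter Topology Set

namespace Literature.Analysis.Calculus

/-! ## §1 Square roots near `1` (inverse function theorem for `a ↦ a²`) -/

section SquareRoot

variable {𝕜 : Type*} [NontriviallyNormedField 𝕜] {B : Type*} [NormedRing B] [NormedAlgebra 𝕜 B] [CompleteSpace B]

/-- **`a ↦ a·a` is a local homeomorphism at `1`** in a complete normed algebra over a field with `2 ≠ 0`: there is an open
neighbourhood `U ∋ 1` on which squaring is injective, and squaring maps neighbourhoods of `1` onto neighbourhoods of `1`
(inverse function theorem: the strict derivative of `a ↦ a·a` at `1` is `2·id`, invertible). [cite: Dieudonne1960, (10.2.5)] -/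
theorem exists_isOpen_injOn_mul_self (h2 : (2 : 𝕜) ≠ 0) :
    ∃ U : Set B, IsOpen U ∧ (1 : B) ∈ U ∧ Set.InjOn (fun a : B => a * a) U ∧
      Filter.map (fun a : B => a * a) (𝓝 1) = 𝓝 1 := by
  set L : B ≃L[𝕜] B := ContinuousLinearEquiv.equivOfInverse ((2 : 𝕜) • ContinuousLinearMap.id 𝕜 B)
    ((2 : 𝕜)⁻¹ • ContinuousLinearMap.id 𝕜 B)
    (fun x => by simp [smul_smul, mul_inv_cancel₀ h2])
    (fun x => by simp [smul_smul, inv_mul_cancel₀ h2]) with hL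
  have hmul := (hasStrictFDerivAt_id (𝕜 := 𝕜) (1 : B)).mul' (hasStrictFDerivAt_id (𝕜 := 𝕜) (1 : B))
  have hfun : ((id : B → B) * id) = fun a : B => a * a := rfl
  rw [hfun] at hmul
  have hd : HasStrictFDerivAt (fun a : B => a * a) (L : B →L[𝕜] B) 1 := by
    refine hmul.congr_fderiv ?_
    ext y
    simp [hL, two_smul]
  refine ⟨(hd.toOpenPartialHomeomorph _).source, (hd.toOpenPartialHomeomorph _).open_source,
    hd.mem_toOpenPartialHomeomorph_source, (hd.toOpenPartialHomeomorph _).injOn, ?_⟩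
  have h := hd.map_nhds_eq_of_equiv
  rwa [mul_one] at h

end SquareRoot

/-! ## §2 Matrix algebras over a complete field and over a finite product of complete fields -/

section MatrixField

variable {K : Type*} [NontriviallyNormedField K] [CompleteSpace K] {n : Type*} [Fintype n] [DecidableEq n]

/-- Square roots near `1` in `M_n(K)`, `K` a complete nontrivially normed field with `2 ≠ 0` (the `L^∞`-operator norm makes
`M_n(K)` a complete normed `K`-algebra with the product topology). [cite: Dieudonne1960, (10.2.5)] -/
theorem exists_isOpen_injOn_mul_self_matrix (h2 : (2 : K) ≠ 0) :
    ∃ U : Set (Matrix n n K), IsOpen U ∧ (1 : Matrix n n K) ∈ U ∧ Set.InjOn (fun a : Matrix n n K => a * a) U ∧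
      Filter.map (fun a : Matrix n n K => a * a) (𝓝 1) = 𝓝 1 := by
  letI : NormedRing (Matrix n n K) := Matrix.linftyOpNormedRing
  letI : NormedAlgebra K (Matrix n n K) := Matrix.linftyOpNormedAlgebra
  -- the `L^∞`-operator-norm uniformity IS the product uniformity (by construction), so the product completeness applies
  exact @exists_isOpen_injOn_mul_self K _ (Matrix n n K) _ _ (inferInstanceAs (CompleteSpace (n → n → K))) h2

end MatrixField

section MatrixPi

variable {ι : Type*} [Fintype ι] {K : ι → Type*} [∀ i, NontriviallyNormedField (K i)] [∀ i, CompleteSpace (K i)]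
  {n : Type*} [Fintype n] [DecidableEq n]

/-- Square roots near `1` in `M_n(∏_i K_i)` for finitely many complete nontrivially normed fields `K_i` with `2 ≠ 0`
(componentwise over the factors `M_n(K_i)`): an open `U ∋ 1` on which squaring is injective, and squaring maps every
neighbourhood of `1` onto a neighbourhood of `1`. [cite: Dieudonne1960, (10.2.5)] -/
theorem exists_isOpen_injOn_mul_self_matrix_pi (h2 : ∀ i, (2 : K i) ≠ 0) :
    ∃ U : Set (Matrix n n (Π i, K i)), IsOpen U ∧ (1 : Matrix n n (Π i, K i)) ∈ U ∧
      Set.InjOn (fun a : Matrix n n (Π i, K i) => a * a) U ∧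
      ∀ V ∈ 𝓝 (1 : Matrix n n (Π i, K i)), (fun a : Matrix n n (Π i, K i) => a * a) '' V ∈ 𝓝 1 := by
  -- the projections `π_i : M_n(∏ K) →+* M_n(K_i)`
  set π : ∀ i, Matrix n n (Π i, K i) →+* Matrix n n (K i) := fun i => (Pi.evalRingHom K i).mapMatrix with hπ
  have hπc : ∀ i, Continuous (π i) := fun i =>
    continuous_id.matrix_map (continuous_apply i)
  have hext : ∀ a b : Matrix n n (Π i, K i), (∀ i, π i a = π i b) → a = b := fun a b h => by
    ext r c i
    exact congr_fun (congr_fun (h i) r) c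
  -- sections
  set ψ : (Π i, Matrix n n (K i)) → Matrix n n (Π i, K i) := fun b => Matrix.of fun r c i => b i r c with hψ
  have hψπ : ∀ b i, π i (ψ b) = b i := fun b i => rfl
  have hψc : Continuous ψ := by
    refine continuous_matrix fun r c => continuous_pi fun i => ?_
    exact ((continuous_apply c).comp ((continuous_apply r).comp (continuous_apply i)))
  have hψ1 : ψ (fun _ => 1) = 1 := hext _ _ fun i => by rw [hψπ, map_one]
  choose U hUo hU1 hUi hUn using fun i => exists_isOpen_injOn_mul_self_matrix (n := n) (h2 i)
  refine ⟨⋂ i, π i ⁻¹' U i, isOpen_iInter_of_finite fun i => (hUo i).preimage (hπc i),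
    Set.mem_iInter.2 fun i => by rw [Set.mem_preimage, map_one]; exact hU1 i, ?_, ?_⟩
  · intro a ha b hb hab
    refine hext a b fun i => hUi i (Set.mem_iInter.1 ha i) (Set.mem_iInter.1 hb i) ?_
    have := congrArg (π i) hab
    simpa only [map_mul] using this
  · intro V hV
    -- a box inside `V`
    have hV' : ψ ⁻¹' V ∈ 𝓝 (fun i => (1 : Matrix n n (K i))) := by
      refine hψc.continuousAt.preimage_mem_nhds ?_
      rwa [hψ1]
    rw [nhds_pi, Filter.mem_pi] at hV'
    obtain ⟨I, -, t, ht, htV⟩ := hV'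
    -- the box `{A | ∀ i, π_i A ∈ (t i)²}` is a neighbourhood of `1` contained in the image
    have hbox : (⋂ i, π i ⁻¹' ((fun a : Matrix n n (K i) => a * a) '' t i)) ∈ 𝓝 (1 : Matrix n n (Π i, K i)) := by
      refine (Filter.iInter_mem).2 fun i => (hπc i).continuousAt.preimage_mem_nhds ?_
      rw [map_one, ← hUn i]
      exact Filter.image_mem_map (ht i)
    refine Filter.mem_of_superset hbox fun A hA => ?_
    have hA' := Set.mem_iInter.1 hA
    choose b hbt hbA using fun i => (Set.mem_image _ _ _).1 (hA' i)
    exact ⟨ψ b, htV (show b ∈ I.pi t from fun i _ => hbt i), hext _ _ fun i => by rw [map_mul, hψπ, hbA]⟩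

end MatrixPi

end Literature.Analysis.Calculus

end
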